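import Summits.Ventures.CertifiedArithmetic.Expansions.WeakExpansionScaleLevels

/-!
# Weakly nonoverlapping expansions, part 9 (§13): Theorem 4, closure under GROW-EXPANSION

HONEST FRAMING (ENGINES group, unit `eng-quad-4`, kernels lane of the `certquad` engine — shared
numerical engines serving client cells; rigour lives in the verifiers; every published number
belongs to a client cell's ledger, not to the engines group): NEW WORK of the lane's Lean line, not a
published result, hence under `Summits/Ventures/` with no citation tag; nothing here is cited anywhere
as a literature fact.  Parts 1–8 (`WeakExpansion*.lean`: the class W = `IsWeakExpansion`, Theorems 1–2
on FAST-EXPANSION-SUM, Theorem 3 on SCALE-EXPANSION) precede.  This file introduces no definitions.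

THEOREM 4 (`growExpansion_isWeakExpansion`, `…_roundTiesEven`).  For any precision `p ≥ 1` and any
round-to-nearest rounding whose roundoff is 2-below its result (`RoundoffBelow 2`, e.g. IEEE
round-half-even): if `e` is a weakly nonoverlapping expansion of floats and `b` a float then
`h = GROW-EXPANSION(e, b)` (Shewchuk's Figure 6: one TWO-SUM chain) is a weakly nonoverlapping
expansion of `m + 1` floats with `Σ hᵢ = b + Σ eᵢ`.  Shewchuk's Theorem 10 gives this for the class
"nonoverlapping" (any tie rule) and, for round-to-even, "nonadjacent"; the class W lies strictly
between.  It is FALSE under round-half-away, round-half-to-zero and round-half-to-odd (the output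
stays nonoverlapping but may acquire a double adjacency): `p = 4`, `e = ⟨1, 2⟩`, `b = 40`,
round-half-away gives `⟨1, −2, 44⟩`; exhaustive check, `p = 4`, `e` weakly nonoverlapping with ≤ 2
components, all floats `b` within the relevant exponent window: 84 288 cases, 0 failures under
round-to-even against 488 / 434 / 1 364 under ties-away / ties-to-zero / ties-to-odd; `p = 3`, ≤ 3
components: 214 112 cases, 0 failures under round-to-even (informal Python enumeration in the exact
rational model, evidence only — the theorem below is the proof).

PROOF (§13.1).  The loop step on `eᵢ = x` (remaining components `xs`, accumulator `Q`) is
`(Q', h) = TWO-SUM(Q, x)`; `|h| ≤ |x|` and `h` is 2-below `Q'` (`RoundoffBelow 2`).  If `x` is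
2-below every later `y` then so is `h`, and by the common grid (`exists_common_grid`, Theorem 10's
engine) `h` is 2-below everything the loop produces later.  Otherwise `|x| = 2^a` is a one-bit number,
every later `y` is a multiple of `2^(a+1)`, and `|h| ≤ 2^a`: so `h` is 2-below every later `y` unless
`|h| = 2^a` EXACTLY, when it is a one-bit number 1-below everything later — a CRITICAL output,
recording that `e` has an adjacency at level `a` (`growExpansion_pairwise_levels`).  Two adjacent
critical outputs force two consecutive adjacency levels in `e`, impossible for weakly nonoverlapping
`e` (part 7, `IsWeakExpansion.not_two_levels`); `isWeakExpansion_of_pairwise_levels` (part 7, with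
`kb = 0`) concludes.
-/

namespace Summit.Ventures.CertifiedArithmetic.Expansions

open Literature.ComputerArithmetic.JeannerodRump2018
open Literature.ComputerArithmetic.BoldoJeannerodMelquiondMuller2023 hiding twoSum twoSum_fst isFloat_twoSum
open Literature.ComputerArithmetic.Shewchuk1997

variable {p : ℕ} {emin : ℤ} {fl : ℚ → ℚ}

/-! ### §13.1  The loop: every output is 2-below everything later, or critical -/

/-- **GROW-EXPANSION on weak input, roundoff 2-below.**  For a float accumulator `Q` and remaining
float components `es` pairwise weakly below: every output `u` is, against every later output `v`,
EITHER 2-below `v`, OR 1-below `v` and a one-bit number `|u| = 2^a` for a level `a` at which the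
remaining input has an adjacency. -/
theorem growExpansion_pairwise_levels (hp : 1 ≤ p) (hfl : IsRoundNearest p emin fl)
    (hfl2 : RoundoffBelow 2 fl) :
    ∀ (es : List ℚ) (Q : ℚ), IsFloat p emin Q → (∀ x ∈ es, IsFloat p emin x) →
      es.Pairwise WeakBelow →
      (growExpansion fl es Q).Pairwise fun u v => Below 2 u v ∨
        (Below 1 u v ∧ ∃ a : ℤ, |u| = (2 : ℚ) ^ (a + 0) ∧
          ¬ es.Pairwise fun x y => |x| = (2 : ℚ) ^ a → Below 2 x y) := by
  have h2 : (2 : ℚ) ≠ 0 := by norm_num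
  intro es
  induction es with
  | nil =>
    intro Q _ _ _
    rw [growExpansion_nil]; exact List.pairwise_singleton _ _
  | cons x xs ih =>
    intro Q hQ hF hW
    obtain ⟨hxF, hxsF⟩ := List.forall_mem_cons.mp hF
    obtain ⟨hx1, hxs⟩ := List.pairwise_cons.mp hW
    rw [growExpansion_cons]
    set Q₁ := (twoSum fl Q x).1 with hQ₁def
    set h := (twoSum fl Q x).2 with hhdef
    have hh : h = Q + x - fl (Q + x) := (twoSum_exact hp hfl hQ hxF).1
    have hQ₁F : IsFloat p emin Q₁ := (isFloat_twoSum hfl Q x).1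
    have hB1 : Below 2 h Q₁ := twoSum_below hp hfl hfl2 hQ hxF
    have hhle : |h| ≤ |x| := by
      rw [hh, abs_sub_comm]; exact (abs_err_add_le hfl hQ hxF).2
    -- the common grid: `h` c-below `Q'` and every later component ⇒ c-below every later output
    have closure : ∀ {c : ℚ}, Below c h Q₁ → (∀ y ∈ xs, Below c h y) →
        ∀ z ∈ growExpansion fl xs Q₁, Below c h z := by
      intro c hcQ hys z hz
      obtain ⟨k, hk, hQk, hck⟩ := hcQ.normalize hQ₁F
      obtain ⟨g, hg, hgk, hcg, hesG⟩ := exists_common_grid hxsF hys hk hck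
      exact ⟨g, onGrid_of_mem_growExpansion hp hfl hg hQ₁F hxsF (hQk.mono hgk) hesG z hz, hcg⟩
    have hrest := pairwise_levels_mono x (ih Q₁ hQ₁F hxsF hxs)
    rw [List.pairwise_cons]
    refine ⟨?_, hrest⟩
    by_cases hall : ∀ y ∈ xs, Below 2 x y
    · exact fun z hz => Or.inl
        (closure hB1 (fun y hy => (hall y hy).mono_left (by norm_num) hhle) z hz)
    push Not at hall
    obtain ⟨y₀, hy₀, hxy₀⟩ := hall
    obtain ⟨a, hxa⟩ : ∃ a : ℤ, |x| = (2 : ℚ) ^ a := by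
      rcases hx1 y₀ hy₀ with hb2 | ⟨-, ha⟩
      · exact absurd hb2 hxy₀
      · exact ha
    have hlev : ¬ (x :: xs).Pairwise fun x y => |x| = (2 : ℚ) ^ a → Below 2 x y :=
      fun hpw => hxy₀ ((List.pairwise_cons.mp hpw).1 y₀ hy₀ hxa)
    -- every later `y` is a multiple of `2^s`, `s ≥ a + 1` (weakly below ⇒ nonoverlapping)
    have hys : ∀ y ∈ xs, ∃ s : ℤ, a + 1 ≤ s ∧ OnGrid s y := by
      intro y hy
      obtain ⟨s, -, hyG, hcs⟩ := (hx1 y hy).below_one.normalize (hxsF y hy)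
      rw [one_mul, hxa] at hcs
      exact ⟨s, (zpow_lt_zpow_iff_right₀ (by norm_num : (1 : ℚ) < 2)).mp hcs, hyG⟩
    have hhle' : |h| ≤ (2 : ℚ) ^ a := hxa ▸ hhle
    by_cases hcrit : |h| = (2 : ℚ) ^ a
    · -- the CRITICAL output: a one-bit number, 1-below everything later, level `a` recorded
      have hb1 : ∀ y ∈ xs, Below 1 h y := by
        intro y hy
        obtain ⟨s, hs, hyG⟩ := hys y hy
        refine ⟨s, hyG, ?_⟩
        rw [one_mul, hcrit]; exact zpow_lt_zpow_right₀ (by norm_num) (by omega)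
      exact fun z hz => Or.inr ⟨closure (hB1.anti (by norm_num)) hb1 z hz, a,
        by rw [add_zero]; exact hcrit, hlev⟩
    · have hlt : |h| < (2 : ℚ) ^ a := lt_of_le_of_ne hhle' hcrit
      have hb2 : ∀ y ∈ xs, Below 2 h y := by
        intro y hy
        obtain ⟨s, hs, hyG⟩ := hys y hy
        refine ⟨s, hyG, ?_⟩
        calc 2 * |h| < 2 * (2 : ℚ) ^ a := by linarith
          _ = (2 : ℚ) ^ (a + 1) := by rw [zpow_add_one₀ h2]; ring
          _ ≤ (2 : ℚ) ^ s := zpow_le_zpow_right₀ (by norm_num) hs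
      exact fun z hz => Or.inl (closure hB1 hb2 z hz)

/-! ### §13.2  Theorem 4 -/

/-- **THEOREM 4 (closure of the class W under GROW-EXPANSION).**  For any precision `p ≥ 1` and any
round-to-nearest rounding whose roundoff is 2-below its result (`RoundoffBelow 2`, e.g. IEEE
round-half-even): if `e` is a weakly nonoverlapping expansion of floats and `b` a float then
`h = GROW-EXPANSION(e, b)` is a weakly nonoverlapping expansion of `m + 1` floats with
`Σ hᵢ = b + Σ eᵢ`.  (False under round-half-away, round-half-to-zero and round-half-to-odd: module
docstring.) -/
theorem growExpansion_isWeakExpansion (hp : 1 ≤ p) (hfl : IsRoundNearest p emin fl)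
    (hfl2 : RoundoffBelow 2 fl) {e : List ℚ} {b : ℚ} (hb : IsFloat p emin b)
    (he : ∀ x ∈ e, IsFloat p emin x) (hexp : IsWeakExpansion e) :
    IsWeakExpansion (growExpansion fl e b) ∧ (growExpansion fl e b).sum = b + e.sum ∧
      (growExpansion fl e b).length = e.length + 1 ∧
      ∀ x ∈ growExpansion fl e b, IsFloat p emin x := by
  obtain ⟨-, hS, hlen, hFl⟩ := growExpansion_nonoverlapping hp hfl hb he hexp.isExpansion
  exact ⟨isWeakExpansion_of_pairwise_levels (kb := 0) hexp
    (growExpansion_pairwise_levels hp hfl hfl2 e b hb he hexp.1), hS, hlen, hFl⟩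

/-- **THEOREM 4 for IEEE round-half-even** (`roundTiesEven`, `p ≥ 1`): GROW-EXPANSION maps weakly
nonoverlapping expansions to weakly nonoverlapping expansions. -/
theorem growExpansion_isWeakExpansion_roundTiesEven (hp : 1 ≤ p) {e : List ℚ} {b : ℚ}
    (hb : IsFloat p emin b) (he : ∀ x ∈ e, IsFloat p emin x) (hexp : IsWeakExpansion e) :
    IsWeakExpansion (growExpansion (roundTiesEven p emin) e b) ∧
      (growExpansion (roundTiesEven p emin) e b).sum = b + e.sum ∧
      (growExpansion (roundTiesEven p emin) e b).length = e.length + 1 ∧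
      ∀ x ∈ growExpansion (roundTiesEven p emin) e b, IsFloat p emin x :=
  growExpansion_isWeakExpansion hp (isRoundNearest_roundTiesEven hp)
    (roundoffBelow_two_roundTiesEven p emin) hb he hexp

end Summit.Ventures.CertifiedArithmetic.Expansions
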